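import Literature.MathematicalPhysics.QuantumFieldTheory.LatticeGauge
import Literature.MathematicalPhysics.QuantumLattice.LatticeGaugeDLRGibbsProofs
import Literature.MathematicalPhysics.QuantumLattice.LatticeGaugeDLRLimitPointsProofs
import Literature.Probability.LatticeModels.GibbsSpecificationDLRProofs
import Literature.Probability.LatticeModels.GibbsSpecificationTilted
import HarnessLib

/-!
# Shen–Zhu–Zhu (S16): the DLR framework conjuncts — proofs

Sibling proof file of `Literature/MathematicalPhysics/QuantumFieldTheory/LatticeGauge.lean`, working
towards the named fact `Literature.MathematicalPhysics.QuantumFieldTheory.shen_zhu_zhu`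
(Shen–Zhu–Zhu, *A stochastic analysis approach to lattice Yang–Mills at strong coupling*,
CMP 400 (2023) 805–851, arXiv:2204.12737: Assumption 1.1, Thm. 1.2, Rem. 1.3 and the corollary
"Mass gap" of §1). No
definition and no named fact is introduced (D-0026); everything here is proved.

Conjunct (i) of `shen_zhu_zhu` is `HasUniqueGibbsMeasure γ = 𝒢(γ).Subsingleton ∧ 𝒢(γ).Nonempty`
for the `SU(N)` Wilson specification `γ = ymSpecification (fundamentalRep (Fin N)) (N * β)`.
This file settles the parts of (i) that belong to the general DLR framework and isolates exactly
what remains of Shen–Zhu–Zhu's theorem: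

* `isSpecification_ymSpecification_of_t2Space`: for a compact **Hausdorff** second-countable
  gauge group and a continuous representation, the lattice Yang–Mills kernels form a
  specification in Georgii's sense (probability, `𝓕_{Λᶜ}`-measurability, properness,
  consistency), by the generic Gibbsian-specification theorem
  `Literature.Probability.LatticeModels.isSpecification_tilted_map_glueWith_pi` and the finite
  range of the boundary Wilson action. (Remark on the named fact
  `Literature.MathematicalPhysics.QuantumLattice.isSpecification_ymSpecification`: as elaborated
  it carries no separation hypothesis on `G`; for a non-`T₀` compact group — e.g. a nontrivial
  finite group with the indiscrete topology, whose Borel σ-algebra is trivial — properness fails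
  for `d ≥ 1`, because the exceptional set `{σ | ∃ e ∉ Λ, σ e ≠ η e}` is non-empty and
  non-measurable, of outer measure `1` (`not_isSpecification_ymSpecification_of_indiscrete`,
  from the general `not_isSpecification_of_measurableSet_trivial`). The Hausdorff version below
  is the one every intended user needs; closed subgroups of `U(N)` are Hausdorff.)
* `ymGibbsMeasures_nonempty`: existence of infinite-volume DLR states at every coupling
  (compactness: limit points of torus states exist and are DLR, the two discharged A9 facts
  `infiniteVolumeLimitPoints_nonempty_holds`, `mem_ymGibbsMeasures_of_mem_infiniteVolumeLimitPoints_holds`).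
  In particular the `Nonempty` half of conjunct (i) of `shen_zhu_zhu` holds for all `d, N, β`
  (`shen_zhu_zhu_nonempty`), and (i) is equivalent to `𝒢.Subsingleton`
  (`shen_zhu_zhu_hasUniqueGibbsMeasure_iff`).
* `IsSpecification.gibbsMeasures_subset_singleton_of_tendsto_integral` (Friedli–Velenik 2017,
  Lemma 6.30, direction 2 ⇒ 1, for a general specification): if for **every** boundary condition
  `η` the kernels `γ_{Λₙ}(· | η)` converge weakly to one probability measure `ν`, then
  `𝒢(γ) ⊆ {ν}`. Combined with existence: `hasUniqueGibbsMeasure_ymSpecification_of_tendsto`.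
  This is precisely the form in which Shen–Zhu–Zhu's Thm. 1.2 (2) with Rem. 1.3 ("the tight limit
  of `μ_{Λ_L,N,β}` when changing the periodic boundary condition to Dirichlet or other boundary
  conditions is also … `μ^{YM}_{N,β}`") yields DLR uniqueness: `shen_zhu_zhu_uniqueness_of_tendsto`.

What is NOT here (and why `shen_zhu_zhu_holds` is not): the convergence hypothesis itself for
`|β| < 1/(16(d-1))` uniformly in `N` (SZZ Thm. 1.2/Thm. 5.1: Langevin dynamics on `SU(N)^{E⁺}`,
Kendall–Cranston coupling, `W₂`-contraction from the Bakry–Émery bound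
`K_S = N/2 - 8N|β|(d-1) > 0`), and the corollary "Mass gap" (Poincaré inequality plus
Guionnet–Zegarlinski commutator bounds for the semigroup). Both rest on Riemannian stochastic
analysis absent from Mathlib and `Literature/`. The classical total-variation Dobrushin
criterion (Friedli–Velenik Thms. 6.31/6.35, with oscillation `δ(Φ_p) ≤ 2N²|β|` of the 't Hooft
plaquette term and `6(d-1)` plaquette-neighbours of a link) only reaches the `N`-dependent range
`|β| < 1/(12(d-1)N²)`; SZZ themselves note (after Rem. 1.3) that a Dobrushin argument would need
the Wasserstein metric for the Riemannian distance and "has not been carried out in detail".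

## References

* H. Shen, R. Zhu, X. Zhu, CMP 400 (2023) 805–851, arXiv:2204.12737, §1 (Assumption 1.1,
  Thm. 1.2, Rem. 1.3, Cor. "Mass gap"), §4.3 (its proof), §5 (Thm. 5.1, coupling).
* S. Friedli, Y. Velenik, *Statistical Mechanics of Lattice Systems* (CUP 2017), Lemma 6.30
  (uniqueness iff convergence for all boundary conditions), §6.10.1 (specifications with an
  a priori measure), Thm. 6.26.
* H.-O. Georgii, *Gibbs Measures and Phase Transitions*, 2nd ed. (de Gruyter 2011), Def. 1.23,
  Def. 2.9, Prop. 2.5, Thm. 4.17.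
* S. Chatterjee, *Yang–Mills for probabilists*, arXiv:1803.01950, §2.
-/

noncomputable section

open MeasureTheory Filter Topology ProbabilityTheory
open scoped BoundedContinuousFunction
open Literature.Probability.LatticeModels
open Literature.MathematicalPhysics.QuantumLattice

namespace Literature.MathematicalPhysics.QuantumFieldTheory

/-! ### Friedli–Velenik Lemma 6.30: uniqueness from convergence for all boundary conditions -/

section Uniqueness

variable {V S : Type*} [MeasurableSpace S] [TopologicalSpace S]

/-- **Uniqueness criterion** (Friedli–Velenik 2017, Lemma 6.30, implication 2 ⇒ 1; dot-notation
extension of `Literature.Probability.LatticeModels.IsSpecification`, declared from the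
`QuantumFieldTheory` directory with its absolute name). Let `γ` be a specification and suppose
that for **every** boundary condition `η` the finite-volume kernels `γ_{Λₙ}(· | η)` along some
sequence of volumes converge weakly (on bounded continuous functions) to one and the same
probability measure `ν`. Then every Gibbs measure of `γ` equals `ν`: `𝒢(γ) ⊆ {ν}`.
Proof as printed: for `μ ∈ 𝒢(γ)` and bounded continuous `f`, `μ(f) = μ(γ_{Λₙ} f)` (DLR) and
`γ_{Λₙ} f → ν(f)` pointwise and boundedly, so `μ(f) = ν(f)` by dominated convergence; bounded
continuous functions separate finite Borel measures (`HasOuterApproxClosed`, e.g. on the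
metrisable configuration spaces of countably many second-countable regular spins).
[cite: FriedliVelenik2017, Lemma 6.30] -/
theorem _root_.Literature.Probability.LatticeModels.IsSpecification.gibbsMeasures_subset_singleton_of_tendsto_integral
    [BorelSpace (V → S)] [HasOuterApproxClosed (V → S)]
    {γ : Specification V S} (hγ : IsSpecification γ) (Λ : ℕ → Finset V)
    (ν : Measure (V → S)) [IsProbabilityMeasure ν]
    (hlim : ∀ (η : V → S) (f : (V → S) →ᵇ ℝ),
      Tendsto (fun n => ∫ σ, f σ ∂(γ (Λ n) η)) atTop (𝓝 (∫ σ, f σ ∂ν))) :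
    gibbsMeasures γ ⊆ {ν} := by
  intro μ hμ
  rw [mem_gibbsMeasures_iff] at hμ
  rw [Set.mem_singleton_iff]
  haveI := hμ.isProbabilityMeasure
  refine ext_of_forall_integral_eq_of_IsFiniteMeasure fun f => ?_
  -- DLR for observables: `μ(γ_{Λ n} f) = μ(f)` for every `n`
  have hDLR : ∀ n, ∫ η, ∫ σ, f σ ∂(γ (Λ n) η) ∂μ = ∫ σ, f σ ∂μ := fun n =>
    hμ.integral_integral_eq hγ (Λ n) (f.integrable μ)
  -- dominated convergence: `μ(γ_{Λ n} f) → μ(ν(f)) = ν(f)`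
  have hconv : Tendsto (fun n => ∫ η, ∫ σ, f σ ∂(γ (Λ n) η) ∂μ) atTop
      (𝓝 (∫ _η, (∫ σ, f σ ∂ν) ∂μ)) := by
    refine tendsto_integral_of_dominated_convergence (fun _ => ‖f‖) (fun n => ?_)
      (integrable_const ‖f‖) (fun n => ae_of_all _ fun η => ?_) (ae_of_all _ fun η => hlim η f)
    · let κ : Kernel (V → S) (V → S) := ⟨γ (Λ n), hγ.measurable_fun (Λ n)⟩
      exact (f.continuous.stronglyMeasurable.integral_kernel (κ := κ)).aestronglyMeasurable
    · haveI := hγ.isProbability (Λ n) η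
      exact f.norm_integral_le_norm (γ (Λ n) η)
  simp only [hDLR, integral_const, smul_eq_mul, probReal_univ, one_mul] at hconv
  exact tendsto_nhds_unique tendsto_const_nhds hconv

end Uniqueness

/-! ### The lattice Yang–Mills specification for a Hausdorff gauge group -/

section YM

variable {d N : ℕ} {G : Type*} [Group G] [TopologicalSpace G] [IsTopologicalGroup G]
  [CompactSpace G] [MeasurableSpace G] [BorelSpace G] (ρ : G →* Matrix (Fin N) (Fin N) ℂ)

omit [TopologicalSpace G] [IsTopologicalGroup G] [CompactSpace G] [MeasurableSpace G]
  [BorelSpace G] in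
/-- Enlarging the edge set enlarges the set of plaquettes touching it. [folklore] -/
theorem plaquettesTouching_mono {Λ Λ' : Finset (ZdEdge d)} (h : Λ ⊆ Λ') :
    plaquettesTouching Λ ⊆ plaquettesTouching Λ' := by
  intro p hp
  obtain ⟨e, he⟩ := mem_plaquettesTouching_iff.1 hp
  exact mem_plaquettesTouching_iff.2
    ⟨e, Finset.mem_inter.2 ⟨(Finset.mem_inter.1 he).1, h (Finset.mem_inter.1 he).2⟩⟩

omit [TopologicalSpace G] [IsTopologicalGroup G] [CompactSpace G] [MeasurableSpace G]
  [BorelSpace G] in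
/-- **Locality of the boundary Wilson action across volumes**: for `Λ ⊆ Λ'`, the difference
`S_{Λ'} - S_Λ = ∑_{p ∩ Λ' ≠ ∅, p ∩ Λ = ∅} (N - Re tr ρ(U_p))` does not depend on the links in `Λ`
(a plaquette not touching `Λ` has no edge in `Λ`) — the relative-energy locality
(Friedli–Velenik 2017, eq. (6.10)) of the Wilson interaction (Seiler LNP 159 Ch. 2). [folklore] -/
theorem dependsOn_wilsonBoundaryAction_sub {Λ Λ' : Finset (ZdEdge d)} (h : Λ ⊆ Λ') :
    DependsOn (fun U : LGConfig d G => wilsonBoundaryAction ρ Λ' U - wilsonBoundaryAction ρ Λ U)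
      ((↑Λ : Set (ZdEdge d))ᶜ) := by
  classical
  intro U U' hUU'
  have hsub := plaquettesTouching_mono (d := d) h
  have key : ∀ p ∈ plaquettesTouching Λ' \ plaquettesTouching Λ,
      plaquetteObs ρ p.1 p.2.1.1 p.2.1.2 U = plaquetteObs ρ p.1 p.2.1.1 p.2.1.2 U' := by
    intro p hp
    rw [Finset.mem_sdiff] at hp
    refine isCylinder_plaquetteObs ρ p fun e he => hUU' e ?_
    rw [Set.mem_compl_iff, Finset.mem_coe]
    exact fun heΛ => hp.2 (mem_plaquettesTouching_iff.2 ⟨e, Finset.mem_inter.2 ⟨he, heΛ⟩⟩)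
  have hsplit : ∀ W : LGConfig d G, wilsonBoundaryAction ρ Λ' W =
      (∑ p ∈ plaquettesTouching Λ' \ plaquettesTouching Λ,
          ((N : ℝ) - plaquetteObs ρ p.1 p.2.1.1 p.2.1.2 W)) + wilsonBoundaryAction ρ Λ W :=
    fun W => (Finset.sum_sdiff hsub).symm
  have hdiff : ∑ p ∈ plaquettesTouching Λ' \ plaquettesTouching Λ,
        ((N : ℝ) - plaquetteObs ρ p.1 p.2.1.1 p.2.1.2 U) =
      ∑ p ∈ plaquettesTouching Λ' \ plaquettesTouching Λ,
        ((N : ℝ) - plaquetteObs ρ p.1 p.2.1.1 p.2.1.2 U') :=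
    Finset.sum_congr rfl fun p hp => by rw [key p hp]
  show wilsonBoundaryAction ρ Λ' U - wilsonBoundaryAction ρ Λ U =
    wilsonBoundaryAction ρ Λ' U' - wilsonBoundaryAction ρ Λ U'
  rw [hsplit U, hsplit U', hdiff]
  ring

/-- **No specification is proper for a spin space with trivial σ-algebra.** If every
measurable subset of `S` is `∅` or `univ` (e.g. the Borel σ-algebra of an indiscrete topology),
`S` has two points and `V` is non-empty, then no kernel family on `V → S` is a specification:
the product σ-algebra is again trivial, so for a probability kernel the non-empty exceptional set
of properness `{σ | ∃ x ∉ Λ, σ x ≠ η x}` (take `Λ = ∅`, `η ≡ y`, `σ ≡ x ≠ y`) has outer measure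
`1`, not `0`. Companion to the warning in the docstring of
`Literature.Probability.LatticeModels.IsSpecification` (unsatisfiability for uncountable `V`);
here the defect is a missing separation hypothesis on `S`. [folklore] -/
theorem _root_.Literature.Probability.LatticeModels.not_isSpecification_of_measurableSet_trivial
    {V S : Type*} [MeasurableSpace S] [Nonempty V]
    (hS : ∀ s : Set S, MeasurableSet s → s = ∅ ∨ s = Set.univ) {x y : S} (hxy : x ≠ y)
    (γ : Specification V S) : ¬ IsSpecification γ := by
  intro hγ
  -- the product σ-algebra on `V → S` is trivial
  have hpi : ∀ A : Set (V → S), MeasurableSet A → A = ∅ ∨ A = Set.univ := by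
    intro A hA
    have hle : (MeasurableSpace.pi : MeasurableSpace (V → S)) ≤ ⊥ := by
      refine iSup_le fun v => MeasurableSpace.comap_le_iff_le_map.2 fun s hs => ?_
      rw [MeasurableSpace.map_def]
      rcases hS s hs with rfl | rfl
      · exact @MeasurableSet.empty _ ⊥
      · exact @MeasurableSet.univ _ ⊥
    exact MeasurableSpace.measurableSet_bot_iff.1 (hle A hA)
  -- properness at `Λ = ∅`, `η ≡ y` says `σ = η` a.s.; but the exceptional set is not null
  obtain ⟨v⟩ := ‹Nonempty V›
  set μ := γ ∅ (fun _ => y)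
  haveI := hγ.isProbability ∅ (fun _ => y)
  have hae := hγ.proper ∅ (fun _ => y)
  rw [ae_iff] at hae
  obtain ⟨t, hBt, ht, hμt⟩ :=
    exists_measurable_superset μ {σ : V → S | ¬ ∀ x ∉ (∅ : Finset V), σ x = (fun _ => y) x}
  have hσ₀ : (fun _ : V => x) ∈ t := hBt fun h => hxy (h v (Finset.notMem_empty v))
  rcases hpi t ht with rfl | rfl
  · exact hσ₀
  · rw [measure_univ] at hμt
    exact one_ne_zero (hμt.trans hae)

/-- **The named fact `isSpecification_ymSpecification` needs a separation hypothesis.** For a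
nontrivial compact group `G` whose topology is indiscrete (only `∅` and `univ` are open — a
compact second-countable topological group) with its (trivial) Borel σ-algebra, and `d ≥ 1`,
the lattice Yang–Mills kernels are **not** a specification, whatever `ρ` and `β`: properness
fails (`not_isSpecification_of_measurableSet_trivial`). Hence
`Literature.MathematicalPhysics.QuantumLattice.isSpecification_ymSpecification ρ` is false for
such `G` and the trivial representation `ρ = 1` (the continuous one there), and only its
Hausdorff version `isSpecification_ymSpecification_of_t2Space` can be discharged. [folklore] -/
theorem not_isSpecification_ymSpecification_of_indiscrete [Nontrivial G] [NeZero d]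
    (hG : ∀ s : Set G, IsOpen s → s = ∅ ∨ s = Set.univ) (β : ℝ) :
    ¬ IsSpecification (ymSpecification (d := d) ρ β) := by
  obtain ⟨g, hg⟩ := exists_ne (1 : G)
  haveI : Nonempty (ZdEdge d) := ⟨(0, ⟨0, Nat.pos_of_ne_zero (NeZero.ne d)⟩)⟩
  refine not_isSpecification_of_measurableSet_trivial (fun s hs => ?_) hg _
  -- Borel sets of an indiscrete space are `∅` or `univ`
  have hle : borel G ≤ ⊥ := MeasurableSpace.generateFrom_le fun t ht => by
    rcases hG t ht with rfl | rfl
    · exact @MeasurableSet.empty _ ⊥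
    · exact @MeasurableSet.univ _ ⊥
  rw [BorelSpace.measurable_eq (α := G)] at hs
  exact MeasurableSpace.measurableSet_bot_iff.1 (hle s hs)

variable [T2Space G] [SecondCountableTopology G]

/-- **The lattice Yang–Mills kernels form a specification** (Hausdorff version of the named fact
`isSpecification_ymSpecification`): for a continuous matrix representation `ρ` of a compact
Hausdorff second-countable group `G` and every `β`, `ymSpecification ρ β` — product Haar measure
on the links of `Λ`, glued with the boundary condition and tilted by `exp(-β S_Λ)` — is a
specification in Georgii's sense (probability, `𝓕_{Λᶜ}`-measurability, properness,
consistency). It is the instance `ν = Haar`, `φ_Λ = -β S_Λ` of the generic theorem on Gibbsian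
specifications with an a priori measure
(`Literature.Probability.LatticeModels.isSpecification_tilted_map_glueWith_pi`, Friedli–Velenik
2017 §6.10.1 with Lemma 6.15): `S_Λ` is continuous, hence measurable and bounded on the compact
configuration space, and `S_{Λ'} - S_Λ` is insensitive to the links in `Λ`
(`dependsOn_wilsonBoundaryAction_sub`). No sign condition on `β` (Georgii 2011, Def. 2.9 with
Prop. 2.5; Seiler LNP 159 Ch. 2). [cite: Georgii2011, Def. 2.9 with Prop. 2.5] -/
theorem isSpecification_ymSpecification_of_t2Space (hρ : Continuous ρ) (β : ℝ) :
    IsSpecification (ymSpecification (d := d) ρ β) := by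
  have hφc : ∀ Λ : Finset (ZdEdge d),
      Continuous fun U : LGConfig d G => -β * wilsonBoundaryAction ρ Λ U := fun Λ =>
    continuous_const.mul (continuous_wilsonBoundaryAction ρ hρ Λ)
  have hloc : ∀ ⦃Λ Λ' : Finset (ZdEdge d)⦄, Λ ⊆ Λ' →
      DependsOn (fun U : LGConfig d G =>
        -β * wilsonBoundaryAction ρ Λ' U - -β * wilsonBoundaryAction ρ Λ U)
        ((↑Λ : Set (ZdEdge d))ᶜ) := by
    intro Λ Λ' h U U' hUU'
    have := dependsOn_wilsonBoundaryAction_sub (G := G) ρ h hUU'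
    show -β * wilsonBoundaryAction ρ Λ' U - -β * wilsonBoundaryAction ρ Λ U =
      -β * wilsonBoundaryAction ρ Λ' U' - -β * wilsonBoundaryAction ρ Λ U'
    linear_combination (-β) * this
  exact isSpecification_tilted_map_glueWith_pi (V := ZdEdge d)
    (QuantumFieldTheory.haarProbability G) (φ := fun Λ U => -β * wilsonBoundaryAction ρ Λ U)
    (fun Λ => (hφc Λ).measurable) (fun Λ => exists_bound_of_continuous (hφc Λ)) hloc

/-- **Existence of infinite-volume lattice Yang–Mills DLR states** at every coupling: for a
continuous representation of a compact Hausdorff second-countable gauge group,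
`𝒢(ymSpecification ρ β) ≠ ∅`. The torus Wilson states have a subsequential infinite-volume
limit by compactness of `G^{edges(ℤ^d)}` (`infiniteVolumeLimitPoints_nonempty_holds`), and every
such limit satisfies the DLR equations (`mem_ymGibbsMeasures_of_mem_infiniteVolumeLimitPoints_holds`;
Georgii 2011 Thm. 4.17) (Chatterjee arXiv:1803.01950 §2, "infinite-volume Gibbs measures exist
by compactness"; Seiler LNP 159 Ch. 2). [cite: arXiv180301950, §2] -/
theorem ymGibbsMeasures_nonempty (hρ : Continuous ρ) (β : ℝ) :
    (ymGibbsMeasures (d := d) ρ β).Nonempty := by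
  obtain ⟨μ, hμ⟩ := infiniteVolumeLimitPoints_nonempty_holds (d := d) ρ hρ β
  exact ⟨μ, mem_ymGibbsMeasures_of_mem_infiniteVolumeLimitPoints_holds ρ hρ hμ⟩

/-- **DLR uniqueness from convergence for all boundary conditions, lattice Yang–Mills form**
(Friedli–Velenik 2017, Lemma 6.30, with existence by compactness): if along some sequence of
finite edge sets the Yang–Mills kernels `γ_{Λₙ}(· | η)` converge weakly to one probability
measure `ν` for every boundary condition `η`, then `ν` is the unique DLR state:
`𝒢(ymSpecification ρ β) = {ν}`, in particular `HasUniqueGibbsMeasure`. This is the form in which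
a Shen–Zhu–Zhu-type result (CMP 400 (2023), Thm. 1.2 (2) with Rem. 1.3: finite-volume measures
with arbitrary boundary conditions have the same infinite-volume limit) implies uniqueness of
the DLR state. [cite: FriedliVelenik2017, Lemma 6.30] -/
theorem hasUniqueGibbsMeasure_ymSpecification_of_tendsto (hρ : Continuous ρ) (β : ℝ)
    (Λ : ℕ → Finset (ZdEdge d)) (ν : Measure (LGConfig d G)) [IsProbabilityMeasure ν]
    (hlim : ∀ (η : LGConfig d G) (f : LGConfig d G →ᵇ ℝ),
      Tendsto (fun n => ∫ U, f U ∂(ymSpecification ρ β (Λ n) η)) atTop (𝓝 (∫ U, f U ∂ν))) :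
    HasUniqueGibbsMeasure (ymSpecification (d := d) ρ β) ∧ ymGibbsMeasures (d := d) ρ β = {ν} := by
  have hsub : ymGibbsMeasures (d := d) ρ β ⊆ {ν} :=
    (isSpecification_ymSpecification_of_t2Space ρ hρ β).gibbsMeasures_subset_singleton_of_tendsto_integral
      Λ ν hlim
  have hne := ymGibbsMeasures_nonempty (d := d) ρ hρ β
  exact ⟨⟨Set.subsingleton_of_subset_singleton hsub, hne⟩, (hne.subset_singleton_iff).1 hsub⟩

end YM

/-! ### S16: the framework halves of conjunct (i) of `shen_zhu_zhu` -/

section S16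

variable {d N : ℕ}

/-- **Existence half of `shen_zhu_zhu` (i)**, for all `d`, `N`, `β`: the 't Hooft-scaled `SU(N)`
Wilson specification `ymSpecification (fundamentalRep (Fin N)) (N * β)` has a DLR state
(compactness; Chatterjee arXiv:1803.01950 §2). Shen–Zhu–Zhu obtain their state `μ^{YM}_{N,β}` the
same way, as a tight limit of the torus measures (CMP 400 (2023), before Thm. 1.2).
[cite: arXiv180301950, §2] -/
theorem shen_zhu_zhu_nonempty (β : ℝ) :
    (gibbsMeasures (ymSpecification (d := d) (fundamentalRep (Fin N)) (N * β))).Nonempty := by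
  -- `SU(N) ⊆ M_N(ℂ)` is second countable (the `Matrix` synonym hides the `Pi` instance and the
  -- `Submonoid` coercion hides the subtype instance)
  haveI : SecondCountableTopology (Matrix (Fin N) (Fin N) ℂ) :=
    inferInstanceAs (SecondCountableTopology (Fin N → Fin N → ℂ))
  haveI : SecondCountableTopology (Matrix.specialUnitaryGroup (Fin N) ℂ) :=
    Topology.IsEmbedding.subtypeVal.secondCountableTopology
  exact ymGibbsMeasures_nonempty (d := d) (fundamentalRep (Fin N))
    (continuous_fundamentalRep (Fin N)) _

/-- Conjunct (i) of `shen_zhu_zhu` is equivalent to bare uniqueness `𝒢.Subsingleton` of the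
`SU(N)` DLR states, existence being settled by `shen_zhu_zhu_nonempty`. [folklore] -/
theorem shen_zhu_zhu_hasUniqueGibbsMeasure_iff (β : ℝ) :
    HasUniqueGibbsMeasure (ymSpecification (d := d) (fundamentalRep (Fin N)) (N * β)) ↔
      (ymGibbsMeasures (d := d) (fundamentalRep (Fin N)) (N * β)).Subsingleton :=
  ⟨fun h => h.1, fun h => ⟨h, shen_zhu_zhu_nonempty β⟩⟩

/-- **Conjunct (i) of `shen_zhu_zhu` from the Shen–Zhu–Zhu convergence statement.** If, at
't Hooft coupling `β`, the `SU(N)` Yang–Mills kernels `γ_{Λₙ}(· | η)` converge weakly along some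
sequence of volumes to a single probability measure for every boundary condition `η` — the DLR
form of Shen–Zhu–Zhu, CMP 400 (2023), Thm. 1.2 (2) with Rem. 1.3 (proved there for
`|β| < 1/(16(d-1))`, `K_S = N/2 - 8N|β|(d-1) > 0`, by the `W₂`-contraction of the Langevin
dynamics, Thm. 5.1) — then the infinite-volume DLR state is unique (Friedli–Velenik 2017,
Lemma 6.30). The convergence hypothesis is the part of the cited theorem not formalised here.
[cite: arXiv220412737, Thm. 1.2 (2) and Rem. 1.3] -/
theorem shen_zhu_zhu_uniqueness_of_tendsto (β : ℝ) (Λ : ℕ → Finset (ZdEdge d))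
    (ν : Measure (LGConfig d (Matrix.specialUnitaryGroup (Fin N) ℂ))) [IsProbabilityMeasure ν]
    (hlim : ∀ (η : LGConfig d (Matrix.specialUnitaryGroup (Fin N) ℂ))
      (f : LGConfig d (Matrix.specialUnitaryGroup (Fin N) ℂ) →ᵇ ℝ),
      Tendsto (fun n => ∫ U, f U ∂(ymSpecification (fundamentalRep (Fin N)) (N * β) (Λ n) η))
        atTop (𝓝 (∫ U, f U ∂ν))) :
    HasUniqueGibbsMeasure (ymSpecification (d := d) (fundamentalRep (Fin N)) (N * β)) ∧
      ymGibbsMeasures (d := d) (fundamentalRep (Fin N)) (N * β) = {ν} := by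
  haveI : SecondCountableTopology (Matrix (Fin N) (Fin N) ℂ) :=
    inferInstanceAs (SecondCountableTopology (Fin N → Fin N → ℂ))
  haveI : SecondCountableTopology (Matrix.specialUnitaryGroup (Fin N) ℂ) :=
    Topology.IsEmbedding.subtypeVal.secondCountableTopology
  exact hasUniqueGibbsMeasure_ymSpecification_of_tendsto (fundamentalRep (Fin N))
    (continuous_fundamentalRep (Fin N)) (N * β) Λ ν hlim

end S16

end Literature.MathematicalPhysics.QuantumFieldTheory
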